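import Literature.Algebra.EuclideanDomain.LengthVersusEuclideanFunction
import Literature.Algebra.EuclideanDomain.UniversalSideDivisors
import Mathlib.RingTheory.Localization.Ideal
import HarnessLib

/-!
# A localization of an `ℓ`-Euclidean domain is `ℓ`-Euclidean; the Euclidean norm `2^ℓ` (Clark 2015, §3.2, Prop. 31, Ex. 3.2)

Topic `Literature/Algebra/EuclideanDomain`, namespace `Literature.Algebra.EuclideanDomain`.  THEOREMS ONLY (no `def`, no
instance, no named fact), all proved, in the vocabulary of `LengthEuclideanRings.lean` / `LengthVersusEuclideanFunction.lean`:
Clark's `ℓ(x) = len(R/(x))` is `Module.length R (R ⧸ Ideal.span {x}) : ℕ∞`, and «`R` is `ℓ`-Euclidean» is spelled out as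
`∀ a b, b ≠ 0 → ∃ q r, a = b * q + r ∧ (r = 0 ∨ ℓ r < ℓ b)` (no new definition).

## Source (read at the page)

P. L. Clark, *A note on Euclidean order types*, Order **32** (2015) 157–178 [Clark2015EuclideanOrderTypes] (materialised
`paper:arxiv-1208.0977`, p0008), §3.2, VERBATIM: «A ring `R` is `ℓ`-Euclidean if the function `x ∈ R ↦ ℓ(x) ∈ Ord•` is a
Euclidean function on `R`. … **Example 3.2:** A norm on a nonzero ring `R` is a function `|·| : R → ℕ` such that
`|x| = 0 ⟺ x = 0`, `|x| = 1 ⟺ x ∈ R×` and `|xy| = |x| |y|` for all `x, y ∈ R`. A ring admitting a norm is necessarily a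
domain … An `ℓ`-Euclidean domain admits a Euclidean norm: `x ∈ R• ↦ 2^{ℓ(x)}`.  **Proposition 31.** A localization of an
`ℓ`-Euclidean domain is `ℓ`-Euclidean.  Proof. Left to the reader.»

## The proof supplied here (Prop. 31)

Let `A` be an `ℓ`-Euclidean domain (hence a PID: a non-zero ideal is generated by an element of least `ℓ`,
`isPrincipalIdealRing_of_remainder`) and `B = M⁻¹A` a localization (`M ≤ A⁰`).  Two comparisons of lengths along
`φ = algebraMap A B`: (i) `ℓ_B(φ x) ≤ ℓ_A(x)` for every `x` (the ideals of `B` embed order-preservingly into those of `A`,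
`IsLocalization.orderEmbedding`, and `len = coheight`, `Module.length_quotient`); (ii) if `b₁ = π₁ ⋯ π_n` is a product of primes of
`A` none of which becomes a unit in `B`, then `ℓ_B(φ b₁) ≥ n = ℓ_A(b₁)` (the chain `(φ b₁) < (φ(π₂⋯π_n)) < … < B`).  Given
`a, b ∈ B`, `b ≠ 0`, write `a = φ(a₀)·u`, `b = φ(b₁)·w` with units `u, w`, where `b₁` is the «`M`-free part» of a numerator of
`b` (drop the prime factors that become units in `B`); divide `a₀ = b₁ q₀ + r₀` in `A` with `r₀ = 0` or `ℓ_A(r₀) < ℓ_A(b₁)`; then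
`a = b·(w⁻¹ φ(q₀) u) + φ(r₀) u` and `ℓ_B(φ(r₀) u) = ℓ_B(φ r₀) ≤ ℓ_A(r₀) < ℓ_A(b₁) ≤ ℓ_B(φ b₁) = ℓ_B(b)`.

## What is formalised

* §1 (any localization of any commutative ring) `length_quotient_span_algebraMap_le` — (i); (domains)
  `length_quotient_span_add_one_le_mul` (`ℓ(y) + 1 ≤ ℓ(p y)` for a non-unit `p`, `y ≠ 0`),
  `card_le_length_quotient_span_multiset_prod` (`ℓ(x₁⋯x_n) ≥ n` for non-zero non-units).
* §2 `exists_multiset_prod_mul_associated` — the `M`-free part of a non-zero element of a PID.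
* §3 **`lengthEuclidean_of_isLocalization`** — PROPOSITION 31.
* §4 **`exists_euclideanNorm_of_lengthEuclidean`** — EXAMPLE 3.2: on an `ℓ`-Euclidean domain, `N(x) = 2^{ℓ(x)}` (`N(0) = 0`)
  is a multiplicative Euclidean norm (`N x = 0 ⟺ x = 0`, `N x = 1 ⟺ x ∈ R×`, `N(xy) = N x · N y`, division with `N r < N b`);
  with `length_quotient_span_mul` (`ℓ(xy) = ℓ(x) + ℓ(y)` for `x, y ≠ 0` in a PID).

## Mathlib / tree search

Mathlib: `Module.length_quotient` (`= Order.coheight`), `Order.coheight_le_coheight_apply_of_strictMono`, `Order.coheight_anti`,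
`Order.coheight_add_one_le`, `IsLocalization.orderEmbedding`, `IsLocalization.surj`, `IsLocalization.map_units`,
`IsLocalization.injective`, `IsLocalization.isDomain_of_le_nonZeroDivisors`, `Ideal.span_singleton_lt_span_singleton`,
`Ideal.span_singleton_mul_right_unit`, `UniqueFactorizationMonoid.factors_prod`, `factors_mul`, `ENat.toNat_add`.  Tree:
`LengthEuclideanRings.lean` (`length_quotient_span_eq_zero_iff`), `LengthVersusEuclideanFunction.lean`
(`length_quotient_span_unit_mul_multiset_prod`, `length_quotient_span_eq_card_factors`, `length_quotient_span_lt_top`),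
`UniversalSideDivisors.lean` (`isPrincipalIdealRing_of_remainder`), `LocalizationOfEuclideanRings.lean` (the `θ`-analogue:
`e(M⁻¹A) ≤ e(A)`; not imported).
-/

namespace Literature.Algebra.EuclideanDomain

universe u v

/-! ## §1 Lengths of cyclic quotients along a localization -/

section Compare

/-- **`ℓ_B(φ x) ≤ ℓ_A(x)`** along a localization `φ : A → B = M⁻¹A`: `len(B/(φ x))` is the coheight of `(φ x)` among the ideals
of `B`, which embed order-preservingly (`J ↦ φ⁻¹ J`) into the ideals of `A` above `(x)`.
[cite: Clark2015EuclideanOrderTypes, Prop. 31 (proof step)] -/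
theorem length_quotient_span_algebraMap_le {A : Type u} [CommRing A] (M : Submonoid A) {B : Type v} [CommRing B]
    [Algebra A B] [IsLocalization M B] (x : A) :
    Module.length B (B ⧸ Ideal.span {algebraMap A B x}) ≤ Module.length A (A ⧸ Ideal.span {x}) := by
  rw [Module.length_quotient, Module.length_quotient]
  have hle : Ideal.span {x} ≤ IsLocalization.orderEmbedding M B (Ideal.span {algebraMap A B x}) := by
    rw [Ideal.span_singleton_le_iff_mem]
    exact Ideal.mem_comap.2 (Ideal.subset_span (Set.mem_singleton _))
  exact (Order.coheight_le_coheight_apply_of_strictMono _ (IsLocalization.orderEmbedding M B).strictMono _).trans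
    (Order.coheight_anti hle)

end Compare

/-- `ℓ` is invariant under multiplication by a unit on the right: `ℓ(x u) = ℓ(x)`.
[cite: Clark2015EuclideanOrderTypes, Prop. 30 (a)] -/
theorem length_quotient_span_mul_unit {R : Type u} [CommRing R] {x u : R} (hu : IsUnit u) :
    Module.length R (R ⧸ Ideal.span {x * u}) = Module.length R (R ⧸ Ideal.span {x}) := by
  rw [Ideal.span_singleton_mul_right_unit hu]

section Domain

variable {R : Type u} [CommRing R] [IsDomain R]

/-- **`ℓ(y) + 1 ≤ ℓ(p·y)`** for a non-unit `p` and `y ≠ 0` in a domain: `(p y) < (y)` strictly, and `len = coheight` drops by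
at least one along a strict inclusion. [cite: Clark2015EuclideanOrderTypes, §3.1 (ℓ(x) = λ_R((x)), the least isotone map)] -/
theorem length_quotient_span_add_one_le_mul {p y : R} (hp : ¬IsUnit p) (hy : y ≠ 0) :
    Module.length R (R ⧸ Ideal.span {y}) + 1 ≤ Module.length R (R ⧸ Ideal.span {p * y}) := by
  rw [Module.length_quotient, Module.length_quotient]
  have hlt : Ideal.span {p * y} < Ideal.span {y} :=
    Ideal.span_singleton_lt_span_singleton.2 ⟨hy, p, hp, mul_comm p y⟩
  exact Order.coheight_add_one_le hlt

/-- **`ℓ(x₁ ⋯ x_n) ≥ n`** for non-zero non-units `x₁, …, x_n` of a domain (iterate the previous lemma).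
[cite: Clark2015EuclideanOrderTypes, §3.1 and Prop. 30 (b) (lower bound half, any domain)] -/
theorem card_le_length_quotient_span_multiset_prod (s : Multiset R) (hs : ∀ x ∈ s, x ≠ 0 ∧ ¬IsUnit x) :
    (Multiset.card s : ℕ∞) ≤ Module.length R (R ⧸ Ideal.span {s.prod}) := by
  induction s using Multiset.induction_on with
  | empty => simp
  | cons p t ih =>
    have hp := hs p (Multiset.mem_cons_self p t)
    have ht : ∀ x ∈ t, x ≠ 0 ∧ ¬IsUnit x := fun x hx => hs x (Multiset.mem_cons_of_mem hx)
    have ht0 : t.prod ≠ 0 := Multiset.prod_ne_zero fun h0 => (ht 0 h0).1 rfl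
    rw [Multiset.prod_cons, Multiset.card_cons, Nat.cast_succ]
    exact (add_le_add_left (ih ht) 1).trans (length_quotient_span_add_one_le_mul hp.2 ht0)

end Domain

/-! ## §2 The `M`-free part of an element of a principal ideal domain -/

section Free

/-- The image of a product of elements with unit images is a unit. [cite: Clark2015EuclideanOrderTypes, Prop. 31 (proof step)] -/
theorem isUnit_algebraMap_multiset_prod {A : Type u} [CommRing A] {B : Type v} [CommRing B] [Algebra A B]
    (Q : Multiset A) (hQ : ∀ q ∈ Q, IsUnit (algebraMap A B q)) : IsUnit (algebraMap A B Q.prod) := by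
  induction Q using Multiset.induction_on with
  | empty => simp
  | cons q t ih =>
    rw [Multiset.prod_cons, map_mul]
    exact (hQ q (Multiset.mem_cons_self q t)).mul (ih fun x hx => hQ x (Multiset.mem_cons_of_mem hx))

/-- **The `M`-free part**: a non-zero `b₀` of a PID `A` is, up to a unit, `P.prod * c` where `P` consists of primes of `A` that
do NOT become units in the localization `B` and `c` becomes a unit in `B` (split the prime factorisation of `b₀` according to
whether `φ(π)` is a unit). [cite: Clark2015EuclideanOrderTypes, Prop. 31 (proof step)] -/
theorem exists_multiset_prod_mul_associated {A : Type u} [CommRing A] [IsDomain A] [IsPrincipalIdealRing A]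
    (B : Type v) [CommRing B] [Algebra A B] {b₀ : A} (hb₀ : b₀ ≠ 0) :
    ∃ (P : Multiset A) (c : A), (∀ p ∈ P, Prime p ∧ ¬IsUnit (algebraMap A B p)) ∧
      IsUnit (algebraMap A B c) ∧ Associated (P.prod * c) b₀ := by
  classical
  set F := UniqueFactorizationMonoid.factors b₀ with hF
  refine ⟨F.filter (fun p => ¬IsUnit (algebraMap A B p)), (F.filter (fun p => IsUnit (algebraMap A B p))).prod,
    fun p hp => ?_, ?_, ?_⟩
  · rw [Multiset.mem_filter] at hp
    exact ⟨UniqueFactorizationMonoid.prime_of_factor p hp.1, hp.2⟩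
  · exact isUnit_algebraMap_multiset_prod _ fun q hq => (Multiset.mem_filter.1 hq).2
  · rw [← Multiset.prod_add, add_comm, Multiset.filter_add_not]
    exact UniqueFactorizationMonoid.factors_prod hb₀

end Free

/-! ## §3 Proposition 31: a localization of an `ℓ`-Euclidean domain is `ℓ`-Euclidean -/

section Prop31

/-- **Proposition 31 (Clark 2015): a localization of an `ℓ`-Euclidean domain is `ℓ`-Euclidean.**  If `ℓ_A(x) = len(A/(x))` is a
Euclidean function on the domain `A` and `B = M⁻¹A` (`M ≤ A⁰`), then `ℓ_B(x) = len(B/(x))` is a Euclidean function on `B`.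
Proof: see the module docstring («Left to the reader» in the source). [cite: Clark2015EuclideanOrderTypes, Prop. 31] -/
theorem lengthEuclidean_of_isLocalization {A : Type u} [CommRing A] [IsDomain A] (M : Submonoid A)
    (B : Type v) [CommRing B] [Algebra A B] [IsLocalization M B] (hM : M ≤ nonZeroDivisors A)
    (hA : ∀ a b : A, b ≠ 0 → ∃ q r : A, a = b * q + r ∧
      (r = 0 ∨ Module.length A (A ⧸ Ideal.span {r}) < Module.length A (A ⧸ Ideal.span {b}))) :
    ∀ a b : B, b ≠ 0 → ∃ q r : B, a = b * q + r ∧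
      (r = 0 ∨ Module.length B (B ⧸ Ideal.span {r}) < Module.length B (B ⧸ Ideal.span {b})) := by
  classical
  haveI : IsDomain B := IsLocalization.isDomain_of_le_nonZeroDivisors B hM
  -- `A` is a PID: a non-zero ideal is generated by an element of least `ℓ`
  haveI : IsPrincipalIdealRing A :=
    isPrincipalIdealRing_of_remainder (fun s b => Module.length A (A ⧸ Ideal.span {s}) < Module.length A (A ⧸ Ideal.span {b}))
      (InvImage.wf _ wellFounded_lt) hA
  have hinj : Function.Injective (algebraMap A B) := IsLocalization.injective B hM
  intro a b hb
  -- numerators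
  obtain ⟨⟨a₀, s⟩, has⟩ := IsLocalization.surj M a
  obtain ⟨⟨b₀, t⟩, hbt⟩ := IsLocalization.surj M b
  simp only at has hbt
  have hsU : IsUnit (algebraMap A B s) := IsLocalization.map_units B s
  have htU : IsUnit (algebraMap A B t) := IsLocalization.map_units B t
  have hb₀ : b₀ ≠ 0 := by
    rintro rfl
    rw [map_zero] at hbt
    exact hb (htU.mul_left_eq_zero.1 hbt)
  -- the `M`-free part `b₁ = P.prod` of `b₀`
  obtain ⟨P, c, hP, hcU, hassoc⟩ := exists_multiset_prod_mul_associated B hb₀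
  obtain ⟨u₀, hu₀⟩ := hassoc
  set b₁ := P.prod with hb₁
  have hb₁0 : b₁ ≠ 0 := Multiset.prod_ne_zero fun h0 => (hP 0 h0).1.ne_zero rfl
  -- `b = φ b₁ * w` for a unit `w`
  obtain ⟨w, hw⟩ : ∃ w : B, IsUnit w ∧ b = algebraMap A B b₁ * w := by
    refine ⟨algebraMap A B c * algebraMap A B (u₀ : A) * ↑(htU.unit⁻¹), ?_, ?_⟩
    · exact ((hcU.mul ((u₀.isUnit).map _)).mul (Units.isUnit _))
    · have h1 : b = algebraMap A B b₀ * ↑(htU.unit⁻¹) := by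
        rw [← hbt, mul_assoc, IsUnit.mul_val_inv, mul_one]
      rw [h1, ← hu₀, map_mul, map_mul]
      ring
  -- divide the numerator of `a` by `b₁` in `A`
  obtain ⟨q₀, r₀, hdiv, hr₀⟩ := hA a₀ b₁ hb₁0
  have ha : a = algebraMap A B a₀ * ↑(hsU.unit⁻¹) := by
    rw [← has, mul_assoc, IsUnit.mul_val_inv, mul_one]
  obtain ⟨winv, hwinv⟩ : ∃ winv : B, w * winv = 1 := hw.1.exists_right_inv
  refine ⟨winv * algebraMap A B q₀ * ↑(hsU.unit⁻¹), algebraMap A B r₀ * ↑(hsU.unit⁻¹), ?_, ?_⟩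
  · -- `a = b q + r`
    have hb1 : algebraMap A B b₁ = b * winv := by
      rw [hw.2, mul_assoc, hwinv, mul_one]
    calc a = algebraMap A B a₀ * ↑(hsU.unit⁻¹) := ha
      _ = (algebraMap A B b₁ * algebraMap A B q₀ + algebraMap A B r₀) * ↑(hsU.unit⁻¹) := by
          rw [hdiv, map_add, map_mul]
      _ = b * (winv * algebraMap A B q₀ * ↑(hsU.unit⁻¹)) + algebraMap A B r₀ * ↑(hsU.unit⁻¹) := by
          rw [hb1]; ring
  · rcases hr₀ with rfl | hr₀
    · left
      rw [map_zero, zero_mul]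
    · right
      have hunit : IsUnit (↑(hsU.unit⁻¹) : B) := Units.isUnit _
      -- `ℓ_B(r) = ℓ_B(φ r₀) ≤ ℓ_A(r₀) < ℓ_A(b₁) = #P ≤ ℓ_B(φ b₁) = ℓ_B(b)`
      have h1 : Module.length B (B ⧸ Ideal.span {algebraMap A B r₀ * ↑(hsU.unit⁻¹)}) ≤
          Module.length A (A ⧸ Ideal.span {r₀}) := by
        rw [length_quotient_span_mul_unit hunit]
        exact length_quotient_span_algebraMap_le M r₀
      have h2 : Module.length A (A ⧸ Ideal.span {b₁}) = Multiset.card P := by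
        have h := length_quotient_span_unit_mul_multiset_prod P (fun p hp => (hP p hp).1) isUnit_one
        rwa [one_mul] at h
      have h3 : (Multiset.card P : ℕ∞) ≤ Module.length B (B ⧸ Ideal.span {algebraMap A B b₁}) := by
        rw [hb₁, map_multiset_prod, ← Multiset.card_map (algebraMap A B) P]
        refine card_le_length_quotient_span_multiset_prod _ fun x hx => ?_
        obtain ⟨p, hp, rfl⟩ := Multiset.mem_map.1 hx
        exact ⟨fun h0 => (hP p hp).1.ne_zero (hinj (by rw [h0, map_zero])), (hP p hp).2⟩
      have h4 : Module.length B (B ⧸ Ideal.span {algebraMap A B b₁}) = Module.length B (B ⧸ Ideal.span {b}) := by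
        rw [hw.2, length_quotient_span_mul_unit hw.1]
      calc Module.length B (B ⧸ Ideal.span {algebraMap A B r₀ * ↑(hsU.unit⁻¹)})
          ≤ Module.length A (A ⧸ Ideal.span {r₀}) := h1
        _ < Module.length A (A ⧸ Ideal.span {b₁}) := hr₀
        _ ≤ Module.length B (B ⧸ Ideal.span {b}) := by rw [h2, ← h4]; exact h3

/-- Prop. 31 for Mathlib's concrete localization `Localization M`. [cite: Clark2015EuclideanOrderTypes, Prop. 31] -/
theorem lengthEuclidean_localization {A : Type u} [CommRing A] [IsDomain A] (M : Submonoid A)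
    (hM : M ≤ nonZeroDivisors A)
    (hA : ∀ a b : A, b ≠ 0 → ∃ q r : A, a = b * q + r ∧
      (r = 0 ∨ Module.length A (A ⧸ Ideal.span {r}) < Module.length A (A ⧸ Ideal.span {b}))) :
    ∀ a b : Localization M, b ≠ 0 → ∃ q r : Localization M, a = b * q + r ∧
      (r = 0 ∨ Module.length (Localization M) (Localization M ⧸ Ideal.span {r}) <
        Module.length (Localization M) (Localization M ⧸ Ideal.span {b})) :=
  lengthEuclidean_of_isLocalization M (Localization M) hM hA

end Prop31

/-! ## §4 Example 3.2: the Euclidean norm `2^{ℓ(x)}` of an `ℓ`-Euclidean domain -/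

section Norm

variable {R : Type u} [CommRing R] [IsDomain R]

/-- **`ℓ(xy) = ℓ(x) + ℓ(y)`** for non-zero `x, y` in a principal ideal domain (`ℓ` counts prime factors, Prop. 30 (b)).
[cite: Clark2015EuclideanOrderTypes, Prop. 30 (b)] -/
theorem length_quotient_span_mul [IsPrincipalIdealRing R] {x y : R} (hx : x ≠ 0) (hy : y ≠ 0) :
    Module.length R (R ⧸ Ideal.span {x * y}) =
      Module.length R (R ⧸ Ideal.span {x}) + Module.length R (R ⧸ Ideal.span {y}) := by
  rw [length_quotient_span_eq_card_factors (mul_ne_zero hx hy), length_quotient_span_eq_card_factors hx,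
    length_quotient_span_eq_card_factors hy, ← Nat.cast_add, ← Multiset.card_add,
    Multiset.card_eq_card_of_rel (UniqueFactorizationMonoid.factors_mul hx hy)]

/-- **Example 3.2 (Clark 2015): an `ℓ`-Euclidean domain admits a Euclidean norm, `x ↦ 2^{ℓ(x)}`.**  On an `ℓ`-Euclidean domain
`R` (so a PID, with `ℓ(x) < ∞` for `x ≠ 0`) the function `N(x) = 2^{ℓ(x)}` for `x ≠ 0`, `N(0) = 0`, is a norm in Clark's sense
— `N x = 0 ⟺ x = 0`, `N x = 1 ⟺ x ∈ R×`, `N(xy) = N(x)·N(y)` — and a Euclidean function (`a = bq + r` with `N r < N b`).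
[cite: Clark2015EuclideanOrderTypes, Example 3.2] -/
theorem exists_euclideanNorm_of_lengthEuclidean
    (hR : ∀ a b : R, b ≠ 0 → ∃ q r : R, a = b * q + r ∧
      (r = 0 ∨ Module.length R (R ⧸ Ideal.span {r}) < Module.length R (R ⧸ Ideal.span {b}))) :
    ∃ N : R → ℕ, (∀ x, N x = 0 ↔ x = 0) ∧ (∀ x, N x = 1 ↔ IsUnit x) ∧ (∀ x y, N (x * y) = N x * N y) ∧
      (∀ x, x ≠ 0 → N x = 2 ^ (Module.length R (R ⧸ Ideal.span {x})).toNat) ∧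
      ∀ a b : R, b ≠ 0 → ∃ q r : R, a = b * q + r ∧ N r < N b := by
  classical
  haveI : IsPrincipalIdealRing R :=
    isPrincipalIdealRing_of_remainder (fun s b => Module.length R (R ⧸ Ideal.span {s}) < Module.length R (R ⧸ Ideal.span {b}))
      (InvImage.wf _ wellFounded_lt) hR
  let ℓ : R → ℕ∞ := fun x => Module.length R (R ⧸ Ideal.span {x})
  have hfin : ∀ {x : R}, x ≠ 0 → ℓ x ≠ ⊤ := fun hx => (length_quotient_span_lt_top hx).ne
  let N : R → ℕ := fun x => if x = 0 then 0 else 2 ^ (ℓ x).toNat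
  have hN0 : ∀ x, N x = 0 ↔ x = 0 := fun x => by
    by_cases hx : x = 0 <;> simp [N, hx]
  have hNpos : ∀ {x : R}, x ≠ 0 → N x = 2 ^ (ℓ x).toNat := fun hx => by simp [N, hx]
  refine ⟨N, hN0, fun x => ?_, fun x y => ?_, fun x hx => hNpos hx, fun a b hb => ?_⟩
  · -- `N x = 1 ⟺ x` is a unit
    by_cases hx : x = 0
    · subst hx
      simp [N]
    · rw [hNpos hx, Nat.pow_eq_one, ENat.toNat_eq_zero, length_quotient_span_eq_zero_iff]
      have h2 : (2 : ℕ) ≠ 1 := by decide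
      constructor
      · rintro (h | h | h)
        exacts [absurd h h2, h, absurd h (hfin hx)]
      · exact fun h => Or.inr (Or.inl h)
  · -- multiplicativity
    by_cases hx : x = 0
    · subst hx; simp [N]
    by_cases hy : y = 0
    · subst hy; simp [N]
    rw [hNpos (mul_ne_zero hx hy), hNpos hx, hNpos hy, ← pow_add]
    congr 1
    show (ℓ (x * y)).toNat = (ℓ x).toNat + (ℓ y).toNat
    rw [← ENat.toNat_add (hfin hx) (hfin hy)]
    exact congrArg ENat.toNat (length_quotient_span_mul hx hy)
  · -- division with remainder
    obtain ⟨q, r, h, hr⟩ := hR a b hb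
    refine ⟨q, r, h, ?_⟩
    by_cases hr0 : r = 0
    · rw [(hN0 r).2 hr0, hNpos hb]
      exact Nat.two_pow_pos _
    · rcases hr with hr | hr
      · exact absurd hr hr0
      · rw [hNpos hr0, hNpos hb]
        apply Nat.pow_lt_pow_right (by norm_num)
        rw [← ENat.coe_lt_coe, ENat.coe_toNat (hfin hr0), ENat.coe_toNat (hfin hb)]
        exact hr

end Norm

end Literature.Algebra.EuclideanDomain
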